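import Summits.BirchSwinnertonDyer.BirchSwinnertonDyer.Theses.AdditiveBranchIMC
import Summits.BirchSwinnertonDyer.Rank1Residual.AdditivePotMult.PotMultCycLowerBoundClass
import Summits.BirchSwinnertonDyer.Rank1Residual.AdditivePotMult.PotMultBranchPAdicGrossZagierRankOne
import Summits.BirchSwinnertonDyer.Rank1Residual.AdditivePotMult.PotMultBranchPAdicGrossZagierCertIff
import HarnessLib

/-!
# Route `AdditiveBranchIMC` (rung K1), crux `MultLower` (item `stmt-BirchSwinnertonDyer-19359`):
# the registered stub `stub_rankOne` and the whole crux, ISOLATED to the tree's typed inputs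

The crux `MultLower` = `∀ W p, r_an ≤ 1 → N10.CellM W p → MissingLowerBoundAt W p` (cell (M): odd
additive `p`, `ord_p j < 0`; `E = V ⊗ χ_{p*}`, `V` multiplicative at `p`). THIS FILE (theorems only, no
definition, no named fact, no `sorry`; every published input a hypothesis BY NAME) records exactly what
the rank-`1` stub and the whole crux are MODULO, in the tree's currencies, so that the item is one typed
object away in each rank:

* §1 `multLower_of_delbourgo2002_of_cycLowerBound` — BOTH ranks at once: Delbourgo 2002 Thm. (A)+(B)
  in the potentially multiplicative case (`hDelM`, n1011-p16's `Delbourgo2002.mainTheorem_potMult`, ANY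
  odd `p`, `ℓ_p = 1`) + Gross–Zagier–Kolyvagin (`hGZK`) + for every (B)-height datum of every pair of
  cell (M): the typed Iwasawa-currency input `CycLowerBoundAt W p Dh` ("the `p`-adic analytic leading term
  divides the algebraic one", Delbourgo 1998 MC (M) ∘ BS-D(p)(ii); OPEN) and the Schneider rider
  (`SchneiderConjecture Dh`, idle in rank `0`) ⟹ the crux `MultLower` BY NAME. The tree's
  `PotMult.missingLowerBoundAt_rankLeOne_of_cycLowerBound` under the dictionary `N10.CellM =
  p ≠ 2 ∧ Addv ∧ ord_p j < 0`.
* §2 `multLower_rankOne_of_facts_of_quadraticBranchLower_of_branchPAdicGrossZagierMult` — the rank-`1`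
  stub MODULO the two typed objects of the route text: the Λ-adic lower divisibility on the quadratic
  branch of every multiplicative twist model (`QuadraticBranchLowerDivisibilityAt V p`, p10) and the
  ONE-TERM mult-branch `p`-adic Gross–Zagier formula `BranchPAdicGrossZagierMultAt W p Dh` (rank `0` a
  theorem, rank `1` OPEN) with the Schneider rider, over `hDelM`, `hmod`, `hmodD`, `hGZK`
  (`PotMult.missingLowerBoundAt_rankOne_of_quadraticBranchLower_of_branchPAdicGrossZagierMult`).
* §3 `missingLowerBoundAt_rankOne_of_classX4M_of_multCert_of_branchPAdicGrossZagierMult` — H3 of the cell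
  (the bookable rank-`1` object carries a PER-PAIR certificate): on X4(M) ∩ {ρ̄ onto} with the unit
  certificate `MultBranchUnitCertificateAt W p` (`‖ϖ·[T¹]B‖_p = 1`, one modular-symbol computation on
  `E♭`), the rank-`1` stub at the pair needs NO main conjecture and NO Schneider input — only
  `BranchPAdicGrossZagierMultAt W p Dh` for ONE (B)-datum (the tree's
  `ClassX4M.bsdp_rankOne_of_katoHalf_of_multCert_of_branchPAdicGrossZagierMult`, Kato 17.4 (3) `hK`).
* §4 `multLower_of_lowerHalfM_of_facts_of_quadraticBranchLower_of_branchPAdicGrossZagierMult` — the crux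
  BY NAME from the tree's rank-`0` conjecture `N10.LowerHalfM` (= `stub_rankZero`, sibling file
  `AdditiveBranchIMCMultLowerRankZero.lean`) and the rank-`1` inputs of §2.

HONEST LABELS: all four are CONDITIONAL (helpers); `CycLowerBoundAt`, `QuadraticBranchLowerDivisibilityAt`
(main-conjecture direction on the `ω^{(p−1)/2}`-branch of a MULTIPLICATIVE form) and
`BranchPAdicGrossZagierMultAt` in rank `1` are NOT in print at any pair (Skinner 2016 / Skinner–Urban
2014: trivial branch; no `p`-adic Gross–Zagier on the cyclotomic `ω^{(p−1)/2}`-branch); the class-wide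
rank-`1` statement is Schneider-bound (barrier `PAdicHeightBarrier`), the per-pair one is not (§3).
Cell (M) stays CONSTRUCTION-shaped; nothing booked.

References: Delbourgo, J. Number Theory 95 (2002) Thm. (A), (B), p. 39 [Delbourgo2002]; Delbourgo,
Compositio Math. 113 (1998) §2.5 [Delbourgo1998]; Kato, Astérisque 295 (2004) Thm. 17.4 (3)
[Kato2004Asterisque]; Mazur–Tate–Teitelbaum 1986 §I.10, §I.13–I.14 [MazurTateTeitelbaum1986Invent];
Miller, LMS J. Comput. Math. 14 (2011) Def. 1.1 [Miller2011LMS].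
-/

set_option autoImplicit false
set_option linter.dupNamespace false

noncomputable section

open scoped Classical MatrixGroups ModularForm

namespace Summit.BirchSwinnertonDyer.BirchSwinnertonDyer.Theorems.AdditiveBranchIMCMultLower

open CongruenceSubgroup WeierstrassCurve Literature.NumberTheory.EllipticCurves
  Literature.NumberTheory.EllipticCurves.ModularForms
  Literature.NumberTheory.EllipticCurves.Rank1Residual
  Literature.NumberTheory.EllipticCurves.Rank1Residual.Typed
  Literature.NumberTheory.EllipticCurves.Delbourgo2002
  Summit.BirchSwinnertonDyer.Rank1Residual.Additive
  Summit.BirchSwinnertonDyer.Rank1Residual.AdditivePotMult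
  Summit.BirchSwinnertonDyer.BirchSwinnertonDyer.Theses.AdditiveBranchIMC

/-! ### §1 The whole crux modulo ONE typed Iwasawa-currency input (+ the Schneider rider) -/

/-- **`MultLower` (both ranks) from Delbourgo 2002 (A)+(B) [(M) case], GZK, and the typed input
`CycLowerBoundAt` with the Schneider rider for every (B)-datum.** For every globally minimal `W`, odd
additive potentially multiplicative `p` (`N10.CellM W p`), `r_an ≤ 1`: granted `hDelM`
(`Delbourgo2002.mainTheorem_potMult`, PUB) and `hGZK` (PUB), IF every height datum `Dh` satisfying
Delbourgo's (B)-clauses has non-degenerate `p`-adic regulator AND satisfies `CycLowerBoundAt W p Dh`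
(OPEN; the lower half of Delbourgo 1998's Main Conjecture (M) at the leading term), THEN
`MissingLowerBoundAt W p` — i.e. the crux BY NAME. Conditional; nothing booked.
[cite: Delbourgo2002, Theorem (A), (B) (p. 40), p. 39 (ℓ_p = 1 for ord_p j < 0)]
[cite: Delbourgo1998, §2.5 Main Conjecture (p. 151) (shape of the typed input)] [cite: Miller2011LMS, Def. 1.1] -/
theorem multLower_of_delbourgo2002_of_cycLowerBound (hDelM : Delbourgo2002.mainTheorem_potMult)
    (hGZK : rank_eq_analyticRank_of_analyticRank_le_one)
    (hlow : ∀ (W : WeierstrassCurve ℚ) [W.IsElliptic] [W.IsGloballyMinimal] (p : ℕ) [Fact p.Prime],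
      N10.CellM W p → W.analyticRank ≤ 1 → ∀ Dh : PAdicHeightData W p, LeadingTermClauses W p Dh →
        SchneiderConjecture Dh ∧ CycLowerBoundAt W p Dh) :
    Summit.BirchSwinnertonDyer.BirchSwinnertonDyer.Theses.AdditiveBranchIMC.MultLower := by
  intro W _ _ p _ hr hc
  have hpm : Summit.BirchSwinnertonDyer.Rank1Residual.AdditivePotMult.PotMult W p := ⟨hc.2.1, hc.2.2⟩
  exact hpm.missingLowerBoundAt_rankLeOne_of_cycLowerBound hDelM hGZK hc.1 hr (hlow W p hc hr)

/-! ### §2 The rank-`1` stub modulo the two typed objects of the route text -/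

/-- **`stub_rankOne` from the branch lower divisibility of the multiplicative twist and the one-term
mult-branch `p`-adic Gross–Zagier (+ Schneider).** Granted `hDelM`, `hmod`, `hmodD`, `hGZK` (PUB): IF at
every pair of cell (M) in analytic rank `1` (i) every globally minimal twist model `V`
(`C • V^{(p*)} = W`) satisfies p10's Λ-adic input `QuadraticBranchLowerDivisibilityAt V p` (the
Skinner–Urban direction on the `ω^{(p−1)/2}`-branch of the MULTIPLICATIVE form `f_V`; OPEN) and (ii)
every (B)-height datum has non-degenerate regulator and satisfies `BranchPAdicGrossZagierMultAt W p Dh`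
(OPEN in rank `1`), THEN the registered rank-`1` stub holds verbatim. The tree's
`PotMult.missingLowerBoundAt_rankOne_of_quadraticBranchLower_of_branchPAdicGrossZagierMult` under the
`N10.CellM` dictionary. Conditional; nothing booked. [cite: Delbourgo2002, Theorem (A), (B) (p. 40)]
[cite: MazurTateTeitelbaum1986Invent, §I.13–I.14 (shape)] [cite: Miller2011LMS, Def. 1.1] -/
theorem multLower_rankOne_of_facts_of_quadraticBranchLower_of_branchPAdicGrossZagierMult
    (hDelM : Delbourgo2002.mainTheorem_potMult) (hmod : hasEntireLFunction_rat)
    (hmodD : nonempty_modularParametrizationData)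
    (hGZK : rank_eq_analyticRank_of_analyticRank_le_one)
    (hc : ∀ (W : WeierstrassCurve ℚ) [W.IsElliptic] [W.IsGloballyMinimal] (p : ℕ) [Fact p.Prime],
      N10.CellM W p → W.analyticRank = 1 →
      ∀ (V : WeierstrassCurve ℚ) [V.IsElliptic] [V.IsGloballyMinimal],
        (∃ C : VariableChange ℚ, C • V.quadraticTwist ((-1) ^ (p / 2) * p : ℚ) = W) →
          QuadraticBranchLowerDivisibilityAt V p)
    (hGZ : ∀ (W : WeierstrassCurve ℚ) [W.IsElliptic] [W.IsGloballyMinimal] (p : ℕ) [Fact p.Prime],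
      N10.CellM W p → W.analyticRank = 1 → ∀ Dh : PAdicHeightData W p, LeadingTermClauses W p Dh →
        SchneiderConjecture Dh ∧ BranchPAdicGrossZagierMultAt W p Dh) :
    ∀ (W : WeierstrassCurve ℚ) [W.IsElliptic] [W.IsGloballyMinimal] (p : ℕ) [Fact p.Prime],
      W.analyticRank = 1 → N10.CellM W p → MissingLowerBoundAt W p := by
  intro W _ _ p _ hr hcM
  have hpm : Summit.BirchSwinnertonDyer.Rank1Residual.AdditivePotMult.PotMult W p := ⟨hcM.2.1, hcM.2.2⟩
  exact hpm.missingLowerBoundAt_rankOne_of_quadraticBranchLower_of_branchPAdicGrossZagierMult hDelM hmod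
    hmodD hGZK hcM.1 hr (hc W p hcM hr) (hGZ W p hcM hr)

/-! ### §3 Rank `1` at a CERTIFIED pair of X4(M): no main conjecture, no Schneider (H3 of the cell) -/

/-- **`stub_rankOne` at a unit-certified pair of X4(M) ∩ {ρ̄ onto}, MODULO the one-term mult-branch
`p`-adic Gross–Zagier for ONE (B)-datum.** `W` globally minimal, `N10.CellM W p` with `E[p]` irreducible
and `ρ̄_{E,p}` onto, `r_an = 1`, the unit certificate `MultBranchUnitCertificateAt W p`
(`‖ϖ·[T¹]L^±_br(f_V, a_p)‖_p = 1` for every twist datum — ONE modular-symbol computation per pair), a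
(B)-datum `Dh` (supplied on (M) by `Delbourgo2002.mainTheorem_potMult`) and
`BranchPAdicGrossZagierMultAt W p Dh`; published: Kato 17.4 (3) (`hK`), `hmodD`, `hGZK`, `hmod`. Then
`MissingLowerBoundAt W p` — in fact `BSD(E,p)` (the tree's
`ClassX4M.bsdp_rankOne_of_katoHalf_of_multCert_of_branchPAdicGrossZagierMult`: the certificate makes
Kato's bound sharp, and Schneider is PROVED there). Per pair; nothing booked.
[cite: Kato2004Asterisque, Thm. 17.4 (3) (p. 273)] [cite: Delbourgo2002, Theorem (B) (p. 40)]
[cite: Miller2011LMS, Def. 1.1] -/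
theorem missingLowerBoundAt_rankOne_of_classX4M_of_multCert_of_branchPAdicGrossZagierMult
    {W : WeierstrassCurve ℚ} [W.IsElliptic] [W.IsGloballyMinimal] {p : ℕ} [Fact p.Prime]
    (hK : Wuthrich2014.kato_halfEigenCharIdeal_dvd_cyclotomicPrime_of_surjective)
    (hmodD : nonempty_modularParametrizationData)
    (hGZK : rank_eq_analyticRank_of_analyticRank_le_one) (hmod : hasEntireLFunction_rat)
    (hc : N10.CellM W p) (hirr : Irr W p) (hsurj : Surj W p) (hr : W.analyticRank = 1)
    (hcert : MultBranchUnitCertificateAt W p)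
    {Dh : PAdicHeightData W p} (hB : LeadingTermClauses W p Dh)
    (hGZ : BranchPAdicGrossZagierMultAt W p Dh) : MissingLowerBoundAt W p := by
  have hX : ClassX4M W p := ⟨⟨hc.1, hc.2.1, hirr⟩, hc.2.1, hc.2.2⟩
  haveI : Finite W.sha := (hGZK W (by rw [hr])).2
  exact (lower_and_upper_of_missingPPartAt W p (missingPPartAt_of_bsdp W p
    (hX.bsdp_rankOne_of_katoHalf_of_multCert_of_branchPAdicGrossZagierMult hK hmodD hGZK hmod hsurj hr
      hcert hB hGZ))).1

/-! ### §4 The crux BY NAME from `N10.LowerHalfM` (= `stub_rankZero`) and the rank-`1` inputs -/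

/-- **`MultLower` from the tree's rank-`0` conjecture `N10.LowerHalfM` (= the registered `stub_rankZero`,
verbatim) and the rank-`1` typed inputs of §2** (the BC3 skeleton's composition `MultLower_of` with both
stubs spelled by tree objects). Conditional; nothing booked. [cite: Delbourgo2002, Theorem (A), (B) (p. 40)]
[cite: Delbourgo1998, Main Conjecture (p. 151) (shape)] [cite: Miller2011LMS, Def. 1.1] -/
theorem multLower_of_lowerHalfM_of_facts_of_quadraticBranchLower_of_branchPAdicGrossZagierMult
    (h₀ : N10.LowerHalfM)
    (hDelM : Delbourgo2002.mainTheorem_potMult) (hmod : hasEntireLFunction_rat)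
    (hmodD : nonempty_modularParametrizationData)
    (hGZK : rank_eq_analyticRank_of_analyticRank_le_one)
    (hc : ∀ (W : WeierstrassCurve ℚ) [W.IsElliptic] [W.IsGloballyMinimal] (p : ℕ) [Fact p.Prime],
      N10.CellM W p → W.analyticRank = 1 →
      ∀ (V : WeierstrassCurve ℚ) [V.IsElliptic] [V.IsGloballyMinimal],
        (∃ C : VariableChange ℚ, C • V.quadraticTwist ((-1) ^ (p / 2) * p : ℚ) = W) →
          QuadraticBranchLowerDivisibilityAt V p)
    (hGZ : ∀ (W : WeierstrassCurve ℚ) [W.IsElliptic] [W.IsGloballyMinimal] (p : ℕ) [Fact p.Prime],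
      N10.CellM W p → W.analyticRank = 1 → ∀ Dh : PAdicHeightData W p, LeadingTermClauses W p Dh →
        SchneiderConjecture Dh ∧ BranchPAdicGrossZagierMultAt W p Dh) :
    Summit.BirchSwinnertonDyer.BirchSwinnertonDyer.Theses.AdditiveBranchIMC.MultLower := by
  intro W _ _ p _ hr hcM
  rcases Nat.le_one_iff_eq_zero_or_eq_one.mp hr with h | h
  · exact h₀ W p h hcM
  · exact multLower_rankOne_of_facts_of_quadraticBranchLower_of_branchPAdicGrossZagierMult hDelM hmod
      hmodD hGZK hc hGZ W p h hcM

end Summit.BirchSwinnertonDyer.BirchSwinnertonDyer.Theorems.AdditiveBranchIMCMultLower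

end
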